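import Mathlib
import Summits.ValiantsHypothesis.ValiantsHypothesis.Theorems.NewtonUnitEquationsDissociatedFixedK
import Summits.ValiantsHypothesis.ValiantsHypothesis.Theorems.DissociatedFixedK.Negative.LoadBearing

/-!
# Crux `TwoProducts` (stmt-ValiantsHypothesis-5906), line `FrameRungTwo`: STUB 1 `stub_classHull`

The registered forward line `Cruxes/TwoProducts/Lines/FrameRungTwo.lean` (rung `FrameRungTwo`: `k` products of `m`
bivariate polynomials drawn from TWO dissociated frames) has three stubs; STUB 1 (`stub_classHull`, "provable: the
floor transported to each frame class") says that the partial sum over the products of ONE frame class `σ`,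
`Σ_{i : c i = σ} Π_j f i j`, obeys the floor's bound `(m t + 2)^C` with `C = C(k)` uniform in the class assignment `c`.
Proof: re-index the class by `Fin k_σ` (`k_σ ≤ k`), apply the PROVED floor
`Theorems.dissociatedFixedK_proof` (crux `DissociatedFixedK`, stmt-5907) with the class frame `A σ`, and take
`C(k) := max_{k' ≤ k} C_floor(k')` (the bound is monotone in the exponent as `m t + 2 ≥ 1`).  The statement below is
the registered one VERBATIM, with `emb` the route's embedding `ℕ² → ℝ²`
(`Theorems.DissociatedFixedK.Negative.emb`, the same function as the line's local `emb`).  STUB 2 (`stub_faceCount`,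
planar face combinatorics) and STUB 3 (`stub_crossCancelCount`, OPEN core) are untouched; nothing here bears on the
crux `TwoProducts` or on `VP ≠ VNP`.
-/

set_option linter.dupNamespace false

namespace Summit.ValiantsHypothesis.ValiantsHypothesis.Theorems.NewtonFramesTwoProducts.FrameRungTwoClassHull

open MvPolynomial
open scoped BigOperators
open Summit.ValiantsHypothesis.ValiantsHypothesis.Theorems.DissociatedFixedK.Negative (emb)

noncomputable section

/-- **STUB 1 of line `FrameRungTwo` (`stub_classHull`), verbatim**: each frame class obeys the floor's bound
`(m t + 2)^{C(k)}`, uniformly in the class assignment. -/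
theorem stub_classHull : ∀ k : ℕ, ∃ C : ℕ, ∀ (m t : ℕ) (A : Fin 2 → Fin m → Finset (Fin 2 →₀ ℕ))
    (c : Fin k → Fin 2) (f : Fin k → Fin m → MvPolynomial (Fin 2) ℂ),
    (∀ σ j, (A σ j).card ≤ t) →
    (∀ i j, (f i j).support ⊆ A (c i) j) →
    (∀ σ, ∀ a b : Fin m → (Fin 2 →₀ ℕ), (∀ j, a j ∈ A σ j) → (∀ j, b j ∈ A σ j) →
        ∑ j, a j = ∑ j, b j → a = b) →
    ∀ σ : Fin 2, (Set.extremePoints ℝ (convexHull ℝ (emb ''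
        ((∑ i ∈ Finset.univ.filter (fun i => c i = σ), ∏ j, f i j).support : Set (Fin 2 →₀ ℕ))))).ncard
      ≤ (m * t + 2) ^ C := by
  classical
  intro k
  have hfloor := Summit.ValiantsHypothesis.Theorems.dissociatedFixedK_proof
  choose Cf hCf using hfloor
  refine ⟨(Finset.range (k + 1)).sup Cf, ?_⟩
  intro m t A c f hA hf hinj σ
  set s : Finset (Fin k) := Finset.univ.filter (fun i => c i = σ) with hs
  set k' : ℕ := s.card with hk'
  have hk'le : k' ≤ k := by
    rw [hk']
    exact (Finset.card_filter_le _ _).trans (by simp)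
  -- re-index the class by `Fin k'`
  set e : ↥s ≃ Fin k' := Fintype.equivFinOfCardEq (Fintype.card_coe s) with he
  set g : Fin k' → Fin m → MvPolynomial (Fin 2) ℂ := fun i' j => f (e.symm i').1 j with hg
  have hsum : (∑ i ∈ s, ∏ j, f i j) = ∑ i', ∏ j, g i' j := by
    rw [← Finset.sum_coe_sort]
    exact Fintype.sum_equiv e _ _ fun x => by simp [hg]
  have hgA : ∀ i' j, (g i' j).support ⊆ A σ j := by
    intro i' j
    have hmem : ((e.symm i').1 : Fin k) ∈ s := (e.symm i').2
    have hci : c (e.symm i').1 = σ := (Finset.mem_filter.mp hmem).2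
    have h := hf (e.symm i').1 j
    rw [hci] at h
    simpa [hg] using h
  have hbound := hCf k' m t (A σ) g (hA σ) hgA (hinj σ)
  rw [hsum]
  calc (Set.extremePoints ℝ (convexHull ℝ (emb '' ((∑ i', ∏ j, g i' j).support : Set (Fin 2 →₀ ℕ))))).ncard
      ≤ (m * t + 2) ^ Cf k' := hbound
    _ ≤ (m * t + 2) ^ (Finset.range (k + 1)).sup Cf :=
        Nat.pow_le_pow_right (by omega) (Finset.le_sup (by simp; omega))

end

end Summit.ValiantsHypothesis.ValiantsHypothesis.Theorems.NewtonFramesTwoProducts.FrameRungTwoClassHull
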